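import Literature.MathematicalPhysics.QuantumFieldTheory.Balaban1983to89.B6RandomWalkL2Schur
import Literature.MathematicalPhysics.QuantumFieldTheory.Balaban1983to89.B6RandomWalkKernel

/-!
# `Balaban1983to89.B6RandomWalkL2Local` — T. Bałaban, *Propagators and renormalization transformations for lattice gauge theories. II*,
# Commun. Math. Phys. **96** (1984) 223–250 [Balaban1984PropagatorsII], Prop. 2.6 (2.140)–(2.141) p. 247 read for the LOCAL letters of a walk:
# A STENCIL-LOCAL OPERATOR (the sup shape (2.51) p. 232 of the letters) WITH BOUNDED STENCIL MULTIPLICITY HAS A BLOCK-`ℓ²` MAJORANT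
# (`B6RandomWalkL2.HasL2Majorant`) — the `ℓ²` twin of `B9Ineq386CommSum.hasMajorant_of_local`, by Schur's test on the entries

statement-level skeleton of published theorems with citation tags; proofs where landed; nothing here is a claim about the Yang–Mills mass gap

WHAT IS PRINTED.  [4] p. 232 after (2.52): *"this property is preserved under the composition of operators possessing it … A summation preserves it
also"*; Prop. 2.6 p. 247, (2.140)–(2.141): *"‖ζGJ‖, ‖ζ∇GJ‖, … ≤ O(1)[…]|ζ|e^{−δ₃d(y,y′)}‖J‖ (2.140) if supp ζ ⊂ Δ(y), y ∈ Λ_j, supp J ⊂ Δ(y′) … The operator G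
can be represented as … (2.141) and the series above is convergent in the norms appearing in the inequalities (2.136)–(2.140)."*; [B9] = T. Bałaban,
*Propagators for lattice gauge theories in a background field*, Commun. Math. Phys. **99** (1985) 389–434 [Balaban1985BackgroundPropagators],
(3.61) p. 402: *"|(V′(A)λ)(x)| ≤ O(1)α₁((Lʲη)⁻¹|(∇_Uλ)(·)| + (Lʲη)⁻²|λ(·)|) restricted to the block containing x"*, p. 403 l. 1–9 («applying Theorem 3.1
for G′(U), the bound (3.63), the representation (3.64) and Lemma 2.1 of [4] we can prove all the statements (3.42)–(3.47) of Theorem 3.1 for the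
operator G′(U′U)»), (3.46) p. 398 (the `L²` members).

WHY THIS FILE (pub-ymgap N06 row 13, the displayed `L²` steps of `B9SectBStepFrameV2.SectBFrame₂`).  The tree's Sect.-B programme (cell `lit-balaban`,
seat r06) transfers the SUP members (3.42) of Theorem 3.1 from `G′(U)` to `G′(U′U)` in the block-majorant calculus `B6RandomWalk.HasMajorant`, whose
local letters (the coefficient, difference and averaging operators of (3.52) ∕ (3.60)) enter through the sup-shape seam
`B9Ineq386CommSum.hasMajorant_of_local`: «`|(Tμ)(x)| ≦ c(y)·B` whenever `|μ| ≦ B` on the stencil of `x`».  The `L²` members (3.46) of `G′(U′U)` were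
reached there only through the KERNEL form of (3.42) (`B9Ineq346L2Final`), which is not satisfied by the genuine multiscale propagators for d ≥ 3
(lit-balaban desk, pub-ymgap ME #13, 2026-08-26).  Print's own route for the `L²` members is the walk summed in `L²` («the series is convergent in
the norms …», [4] p. 247; [B9] p. 403 ∕ 407), i.e. the block-`ℓ²` calculus `B6RandomWalkL2` ∕ `…L2Chain` (seat p22) — which needs the LOCAL letters as
`HasL2Majorant`s.  THIS FILE is that seam: the same sup-stencil hypothesis the sup programme already verifies for every letter, PLUS a bound `N` on
the stencil multiplicity (every point lies in the stencil of at most `N` points — 1 for a pointwise multiplier, `2|κ|+1` for nearest neighbours),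
gives the block-`ℓ²` majorant `c(y)·√N·e^{δd₀}e^{−δd(y,y′)}`.

WHAT IS PROVED (0 sorry, 0 new named facts; standard axioms).
* §1 `StencilLocal near c T` (the sup-stencil shape, named) and the ENTRIES of such an operator: `entry_eq_zero_of_not_near` (the matrix entry
  `T(δ_{x′})(x)` vanishes off the stencil), `abs_entry_le` (`≦ c(x)`), `sum_abs_entry_le` (row sums `Σ_{x′}|T(δ_{x′})(x)| ≦ c(x)`, by the sign test
  function), `c_nonneg`.
* §2 ★ `hasL2Majorant_of_local`: `StencilLocal near (c ∘ blk) T`, multiplicity `#{x | near x x′} ≦ N` (as a covering finset), stencil range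
  `d(blk x, blk x′) ≦ d₀` ⟹
  `HasL2Majorant blk T (c(y)·√N·e^{δd₀}·e^{−δd(y,y′)})`.  Proof: Schur's test on the entries — `|Tu(x)|² ≦ (Σ_{x′}|t_{xx′}|)(Σ_{x′}|t_{xx′}|u(x′)²) ≦
  c(y)Σ_{x′}|t_{xx′}|u(x′)²` (Cauchy–Schwarz), column sums over `Δ(y)` `≦ N·c(y)`; locality as in the sup seam (either some point of `Δ(y)` sees `Δ(y′)`
  through its stencil, so `d(y,y′) ≦ d₀`, or `Δ(y)Tu = 0`).

HONEST SCOPE.  Pure finite-dimensional bookkeeping ([4] vocabulary, any block map on any finite carrier); no operator of the paper appears; the vector-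
valued seam (real coordinates `B9Eq352DivFormLetters.conj b`) and the letters of (3.60) in `ℓ²` form are the sequel.  NOT summit progress; count-neutral.
Cell `pub-ymgap` (HUMAN RULING D-0062), Track A node N06 [B9], seat `pub-ymgap-dag-n06-c` (g4), 2026-08-27.

RELATED IN THE TREE, NOT DUPLICATED: `B6RandomWalkL2` ∕ `B6RandomWalkL2Schur` (`HasL2Majorant`, `hasL2Majorant_of_hasMajorant_pair` = Schur from a sup
majorant of `T` AND of its transpose — not available for the conjugated vector-valued letters, whence the entries route here), `B6RandomWalkKernel.apply_eq_sum_single`,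
`B9Ineq386CommSum.hasMajorant_of_local` (the sup twin) — all USED or paralleled BY NAME; no existing module modified.
-/

noncomputable section

open scoped BigOperators
open Finset

namespace Literature.MathematicalPhysics.QuantumFieldTheory.Balaban1983to89.B6RandomWalkL2Local

open Literature.MathematicalPhysics.QuantumFieldTheory.Balaban1983to89.B6RandomWalk (blockPiece)
open Literature.MathematicalPhysics.QuantumFieldTheory.Balaban1983to89.B6RandomWalkL2 (l2n l2n_nonneg l2n_sq HasL2Majorant
  hasL2Majorant_mono)
open Literature.MathematicalPhysics.QuantumFieldTheory.Balaban1983to89.B6RandomWalkKernel (apply_eq_sum_single)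

variable {g : B6.Geometry} {W : Type} [Fintype W] [DecidableEq W]

/-! ## §1  Entries of a stencil-local operator -/

section Entries

variable (near : W → W → Prop) {c : W → ℝ} {T : Module.End ℝ (W → ℝ)}

/-- A STENCIL-LOCAL operator in the sup shape of [4] (2.51) ∕ [B9] (3.61): `|(Tμ)(x)| ≦ c(x)·B` whenever `|μ| ≦ B` on the stencil of `x`.
[cite: Balaban1984PropagatorsII, (2.51) p.232; Balaban1985BackgroundPropagators, (3.61) p.402] -/
def StencilLocal (c : W → ℝ) (T : Module.End ℝ (W → ℝ)) : Prop :=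
  ∀ (μ : W → ℝ) (x : W) (B : ℝ), (∀ x', near x x' → |μ x'| ≤ B) → |T μ x| ≤ c x * B

variable {near}

omit [Fintype W] in
/-- The matrix entry `T(δ_{x′})(x)` of a stencil-local operator VANISHES off the stencil of `x`. [cite: Balaban1984PropagatorsII, (2.51) p.232 (bookkeeping, ours)] -/
theorem entry_eq_zero_of_not_near (hT : StencilLocal near c T) {x x' : W} (h : ¬ near x x') :
    T (Pi.single x' 1) x = 0 := by
  have hB : ∀ x'', near x x'' → |(Pi.single x' (1 : ℝ) : W → ℝ) x''| ≤ 0 := by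
    intro x'' hx''
    have hne : x'' ≠ x' := fun e => h (e ▸ hx'')
    simp [Pi.single_eq_of_ne hne]
  have h1 : |T (Pi.single x' 1) x| ≤ c x * 0 := hT _ x 0 hB
  rw [mul_zero] at h1
  exact abs_eq_zero.1 (le_antisymm h1 (abs_nonneg _))

omit [Fintype W] in
/-- The entries of a stencil-local operator are bounded by `c(x)`. [cite: Balaban1984PropagatorsII, (2.51) p.232 (bookkeeping, ours)] -/
theorem abs_entry_le (hT : StencilLocal near c T) (x x' : W) : |T (Pi.single x' 1) x| ≤ c x := by
  have hB : ∀ x'', near x x'' → |(Pi.single x' (1 : ℝ) : W → ℝ) x''| ≤ 1 := by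
    intro x'' _
    by_cases e : x'' = x'
    · subst e; simp
    · simp [Pi.single_eq_of_ne e]
  simpa using hT _ x 1 hB

/-- THE ROW SUMS: `Σ_{x′} |T(δ_{x′})(x)| ≦ c(x)` (test with the sign pattern of the row). [cite: Balaban1984PropagatorsII, (2.51) p.232 (bookkeeping, ours)] -/
theorem sum_abs_entry_le (hT : StencilLocal near c T) (x : W) : ∑ x', |T (Pi.single x' 1) x| ≤ c x := by
  classical
  -- the sign pattern of the row, a test function bounded by 1
  set μ : W → ℝ := fun x' => if 0 ≤ T (Pi.single x' 1) x then 1 else -1 with hμ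
  have hμ1 : ∀ x', |μ x'| ≤ 1 := fun x' => by
    by_cases h : 0 ≤ T (Pi.single x' 1) x <;> simp [hμ, h]
  have hTμ : T μ x = ∑ x', |T (Pi.single x' 1) x| := by
    rw [apply_eq_sum_single T μ x]
    refine Finset.sum_congr rfl fun x' _ => ?_
    by_cases h : 0 ≤ T (Pi.single x' 1) x
    · simp [hμ, h, abs_of_nonneg h]
    · simp [hμ, h, abs_of_neg (lt_of_not_ge h)]
  have h1 : |T μ x| ≤ c x * 1 := hT μ x 1 fun x' _ => hμ1 x'
  rw [mul_one, hTμ, abs_of_nonneg (Finset.sum_nonneg fun _ _ => abs_nonneg _)] at h1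
  exact h1

omit [Fintype W] in
/-- `c(x) ≧ 0` automatically (when the stencil-local bound holds). [cite: Balaban1984PropagatorsII, (2.51) p.232 (bookkeeping, ours)] -/
theorem c_nonneg (hT : StencilLocal near c T) (x : W) : 0 ≤ c x :=
  (abs_nonneg _).trans (abs_entry_le hT x x)

end Entries

/-! ## §2  The block-ℓ² majorant of a stencil-local operator with bounded stencil multiplicity -/

section L2

variable (blk : W → g.Site) (near : W → W → Prop)

/-- **A STENCIL-LOCAL OPERATOR WITH STENCIL MULTIPLICITY `≦ N` HAS THE BLOCK-ℓ² MAJORANT `c·√N·e^{δd₀}e^{−δd(y,y′)}`** (the ℓ² twin of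
`B9Ineq386CommSum.hasMajorant_of_local`, the shape [4] (2.140) expects of the LOCAL letters of a walk): if `|(Tμ)(x)| ≦ c(y)·B` whenever
`|μ| ≦ B` on the stencil of `x` (`y` the block of `x`, `c ≧ 0`), every point lies in the stencil of at most `N` points (a covering finset of
cardinality `≦ N`, no decidability asked), and the stencil of
`x` lies in blocks at distance `≦ d₀` from `y`, then for `supp u ⊂ Δ(y′)`: `‖Δ(y)·Tu‖ ≦ c(y)√N·e^{δd₀}e^{−δd(y,y′)}‖u‖`.  Proof: Schur on the
entries — row sums `≦ c(y)` (`sum_abs_entry_le`), entries `≦ c(y)` supported on the stencil, so column sums over `Δ(y)` are `≦ N·c(y)`.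
[cite: Balaban1984PropagatorsII, (2.51) p.232 + Prop. 2.6 (2.140) p.247; derivation ours (Schur test on the entries)] -/
theorem hasL2Majorant_of_local (c : g.Site → ℝ) (d₀ δ : ℝ) (N : ℕ)
    (hc : ∀ a, 0 ≤ c a) (hδ : 0 ≤ δ) (hnear : ∀ x x', near x x' → g.dist (blk x) (blk x') ≤ d₀)
    (hmult : ∀ x' : W, ∃ s : Finset W, (s.card : ℝ) ≤ N ∧ ∀ x, near x x' → x ∈ s)
    {T : Module.End ℝ (W → ℝ)} (hT : StencilLocal near (fun x => c (blk x)) T) :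
    HasL2Majorant blk T (fun a b => c a * Real.sqrt N * Real.exp (δ * d₀) * Real.exp (-(δ * g.dist a b))) := by
  classical
  intro y y' u hu
  -- abbreviations: the entries t x x′ and their properties
  set t : W → W → ℝ := fun x x' => T (Pi.single x' 1) x with ht
  have ht0 : ∀ x x', ¬ near x x' → t x x' = 0 := fun x x' h => entry_eq_zero_of_not_near hT h
  have htle : ∀ x x', |t x x'| ≤ c (blk x) := fun x x' => abs_entry_le hT x x'
  have hrow : ∀ x, ∑ x', |t x x'| ≤ c (blk x) := fun x => sum_abs_entry_le hT x
  have hTu : ∀ x, T u x = ∑ x', u x' * t x x' := fun x => apply_eq_sum_single T u x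
  -- (1) pointwise Cauchy–Schwarz: |Tu(x)|² ≤ (Σ|t|)(Σ|t|u²) ≤ c(y)·Σ_{x′}|t x x′| u(x′)²  for x ∈ Δ(y)
  have hpt : ∀ x, blk x = y → (T u x) ^ 2 ≤ c y * ∑ x', |t x x'| * u x' ^ 2 := by
    intro x hx
    have hcs := Finset.sum_mul_sq_le_sq_mul_sq (Finset.univ : Finset W)
      (fun x' => Real.sqrt |t x x'|) (fun x' => Real.sqrt |t x x'| * |u x'|)
    have e1 : ∀ x', Real.sqrt |t x x'| * (Real.sqrt |t x x'| * |u x'|) = |t x x'| * |u x'| := fun x' => by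
      rw [← mul_assoc, Real.mul_self_sqrt (abs_nonneg _)]
    have e2 : ∀ x', Real.sqrt |t x x'| ^ 2 = |t x x'| := fun x' => Real.sq_sqrt (abs_nonneg _)
    have e3 : ∀ x', (Real.sqrt |t x x'| * |u x'|) ^ 2 = |t x x'| * u x' ^ 2 := fun x' => by
      rw [mul_pow, Real.sq_sqrt (abs_nonneg _), sq_abs]
    simp only [e1, e2, e3] at hcs
    have habs : |T u x| ≤ ∑ x', |t x x'| * |u x'| := by
      rw [hTu x]
      refine (Finset.abs_sum_le_sum_abs _ _).trans (le_of_eq (Finset.sum_congr rfl fun x' _ => ?_))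
      rw [abs_mul, mul_comm]
    have h0 : 0 ≤ ∑ x', |t x x'| * |u x'| := Finset.sum_nonneg fun _ _ => mul_nonneg (abs_nonneg _) (abs_nonneg _)
    calc (T u x) ^ 2 = |T u x| ^ 2 := (sq_abs _).symm
      _ ≤ (∑ x', |t x x'| * |u x'|) ^ 2 := pow_le_pow_left₀ (abs_nonneg _) habs 2
      _ ≤ (∑ x', |t x x'|) * ∑ x', |t x x'| * u x' ^ 2 := hcs
      _ ≤ c y * ∑ x', |t x x'| * u x' ^ 2 :=
          mul_le_mul_of_nonneg_right (hx ▸ hrow x) (Finset.sum_nonneg fun _ _ => mul_nonneg (abs_nonneg _) (sq_nonneg _))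
  -- (2) column sums over Δ(y): Σ_{x ∈ Δ(y)} |t x x′| ≤ N·c(y)
  have hcol : ∀ x', ∑ x, (if blk x = y then |t x x'| else 0) ≤ N * c y := by
    intro x'
    obtain ⟨s, hs, hcover⟩ := hmult x'
    calc ∑ x, (if blk x = y then |t x x'| else 0)
        ≤ ∑ x, (if x ∈ s then c y else 0) := Finset.sum_le_sum fun x _ => by
            by_cases hn : near x x'
            · have hxs : x ∈ s := hcover x hn
              by_cases hx : blk x = y
              · simp only [hx, hxs, if_true]; exact hx ▸ htle x x'
              · simp only [hx, hxs, if_true, if_false]; exact hc y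
            · have : (if blk x = y then |t x x'| else 0) = 0 := by simp [ht0 x x' hn]
              rw [this]
              by_cases hxs : x ∈ s
              · simp only [hxs, if_true]; exact hc y
              · simp [hxs]
      _ = (s.card : ℝ) * c y := by
            rw [Finset.sum_ite_mem, Finset.univ_inter, Finset.sum_const, nsmul_eq_mul]
      _ ≤ N * c y := mul_le_mul_of_nonneg_right hs (hc y)
  -- (3) sum over the block: ‖Δ(y)Tu‖² ≤ c(y)·(N c(y))·‖u‖²
  have hsq : l2n (blockPiece blk y (T u)) ^ 2 ≤ (c y * Real.sqrt N * l2n u) ^ 2 := by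
    rw [l2n_sq, mul_pow, mul_pow, Real.sq_sqrt (Nat.cast_nonneg N), l2n_sq]
    calc ∑ x, (blockPiece blk y (T u) x) ^ 2
        = ∑ x, (if blk x = y then (T u x) ^ 2 else 0) := Finset.sum_congr rfl fun x _ => by
            by_cases hx : blk x = y <;> simp [blockPiece, hx]
      _ ≤ ∑ x, (if blk x = y then c y * ∑ x', |t x x'| * u x' ^ 2 else 0) := Finset.sum_le_sum fun x _ => by
            by_cases hx : blk x = y
            · simp only [hx, if_true]; exact hpt x hx
            · simp [hx]
      _ = c y * ∑ x', u x' ^ 2 * ∑ x, (if blk x = y then |t x x'| else 0) := by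
            rw [Finset.mul_sum]
            have : ∀ x, (if blk x = y then c y * ∑ x', |t x x'| * u x' ^ 2 else 0)
                = ∑ x', c y * ((if blk x = y then |t x x'| else 0) * u x' ^ 2) := fun x => by
              by_cases hx : blk x = y
              · simp only [hx, if_true, Finset.mul_sum]
              · simp [hx]
            simp only [this]
            rw [Finset.sum_comm]
            refine Finset.sum_congr rfl fun x' _ => ?_
            rw [Finset.mul_sum, Finset.mul_sum]
            refine Finset.sum_congr rfl fun x _ => ?_
            ring
      _ ≤ c y * ∑ x', u x' ^ 2 * (N * c y) := by
            refine mul_le_mul_of_nonneg_left (Finset.sum_le_sum fun x' _ => ?_) (hc y)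
            exact mul_le_mul_of_nonneg_left (hcol x') (sq_nonneg _)
      _ = c y ^ 2 * (N : ℝ) * ∑ x', u x' ^ 2 := by rw [← Finset.sum_mul]; ring
  have hmain : l2n (blockPiece blk y (T u)) ≤ c y * Real.sqrt N * l2n u := by
    have h0 : 0 ≤ c y * Real.sqrt N * l2n u := mul_nonneg (mul_nonneg (hc y) (Real.sqrt_nonneg _)) (l2n_nonneg u)
    have := Real.sqrt_le_sqrt hsq
    rwa [Real.sqrt_sq (l2n_nonneg _), Real.sqrt_sq h0] at this
  -- (4) locality: either some point of Δ(y) sees Δ(y′) through its stencil (then d(y,y′) ≤ d₀), or Δ(y)Tu = 0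
  by_cases hsee : ∃ x x', blk x = y ∧ near x x' ∧ blk x' = y'
  · obtain ⟨x, x', hx, hxx', hx'⟩ := hsee
    have hd : g.dist y y' ≤ d₀ := by rw [← hx, ← hx']; exact hnear x x' hxx'
    have he : 1 ≤ Real.exp (δ * d₀) * Real.exp (-(δ * g.dist y y')) := by
      rw [← Real.exp_add]; exact Real.one_le_exp (by nlinarith)
    have h0 : 0 ≤ c y * Real.sqrt N * l2n u := mul_nonneg (mul_nonneg (hc y) (Real.sqrt_nonneg _)) (l2n_nonneg u)
    calc l2n (blockPiece blk y (T u)) ≤ c y * Real.sqrt N * l2n u := hmain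
      _ = (c y * Real.sqrt N * l2n u) * 1 := (mul_one _).symm
      _ ≤ (c y * Real.sqrt N * l2n u) * (Real.exp (δ * d₀) * Real.exp (-(δ * g.dist y y'))) :=
          mul_le_mul_of_nonneg_left he h0
      _ = c y * Real.sqrt N * Real.exp (δ * d₀) * Real.exp (-(δ * g.dist y y')) * l2n u := by ring
  · -- Δ(y)Tu = 0: every entry t x x′ with x ∈ Δ(y), x′ ∈ Δ(y′) vanishes
    have hzero : blockPiece blk y (T u) = 0 := by
      funext x
      by_cases hx : blk x = y
      · simp only [blockPiece, hx, if_true, Pi.zero_apply]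
        rw [hTu x]
        refine Finset.sum_eq_zero fun x' _ => ?_
        by_cases hx' : blk x' = y'
        · have hn : ¬ near x x' := fun hn => hsee ⟨x, x', hx, hn, hx'⟩
          rw [ht0 x x' hn, mul_zero]
        · rw [hu x' hx', zero_mul]
      · simp [blockPiece, hx]
    rw [hzero]
    have : l2n (0 : W → ℝ) = 0 := by
      have h := l2n_sq (0 : W → ℝ)
      simp only [Pi.zero_apply, ne_eq, OfNat.ofNat_ne_zero, not_false_eq_true, zero_pow, Finset.sum_const_zero] at h
      exact pow_eq_zero_iff (n := 2) (by norm_num) |>.1 h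
    rw [this]
    exact mul_nonneg (mul_nonneg (mul_nonneg (mul_nonneg (hc y) (Real.sqrt_nonneg _)) (Real.exp_nonneg _))
      (Real.exp_nonneg _)) (l2n_nonneg u)

end L2

end Literature.MathematicalPhysics.QuantumFieldTheory.Balaban1983to89.B6RandomWalkL2Local
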